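import Summits.Ventures.WeilGRH.UniformConductorFloorJointFloorsLog8
import Summits.Ventures.WeilGRH.UniformConductorFloorJointEvenLog9Check
import Summits.Ventures.WeilGRH.UniformConductorFloorJointOddLog9Check
import Summits.Ventures.WeilGRH.UniformConductorFloorJointEvenLog9CheckB
import Summits.Ventures.WeilGRH.UniformConductorFloorJointOddLog9CheckB
import Summits.Ventures.WeilGRH.UniformConductorFloorCellsOne
import Summits.Ventures.WeilGRH.UniformConductorFloorRungs
import HarnessLib

/-!
# GRH arm (rh-explicit, venture WeilGRH): ★ the rung `t = log 3` for EVERY Dirichlet character of EVERY modulus `q ≥ 133`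
  (odd characters: `q ≥ 49`) — the joint cell certificates

Cell `rh-explicit`, WEIL TRACK — GRH ARM (weil-grh-1).  The uniform conductor floor of the arm at the rung `t = (log 9)/2 = log 3`
(the prime powers `8` and `9` inside the window), from the joint cell certificates `certEvenLog9` / `certOddLog9`
(`UniformConductorFloorJointDataLog9.lean`; `R = 320`, `J = 352`, window `t = 352 log(320/319) = 1.1017 ≥ log 3`, `N = 9`),
kernel-checked in `…JointEvenLog9Check(B).lean` / `…JointOddLog9Check(B).lean` (cells in two ranges of 176), through `JointCert.weilPositivityOnChar_of_parts`:

* ★ `weilPositivityOnChar_log_three_of_ge_133` — EVERY Dirichlet character of EVERY modulus `q ≥ 133` satisfies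
  `WeilPositivityOnChar χ (log 3)` (hence every window `t ≤ log 3`);
* ★ `weilPositivityOnChar_log_three_of_odd_ge_49` — every ODD character of every modulus `q ≥ 49`.

Inputs beyond the certificates: `UniformFloor.wbar7_ge` (`n ≤ 7`), `Λ(8)/√8 ≤ 0.24507` (`…FloorsLog8.lean`),
`Λ(9)/√9 = log 3/3 ≤ 0.3662041`, `UniformFloor.psi_even_ge` / `psi_odd_ge`, `log 133 ≥ 7 log 2 + 5/133`,
`log 49 ≥ 4 log 2 + log 3 + 1/49`, and `3·319^352 ≤ 320^352` for the window.  Honest scope: a finite-window statement for large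
moduli (method floors 132.4 / 48.5; the exact pseudo-key floors at this rung are not tabulated by the cell); no `ζ` input;
standard axioms.

## References

* A. Weil (1952), (11) pp. 261–262 and the «lemme» p. 262 [Weil1952FormulesExplicites]; L. Collatz (1942) / H. Wielandt (1950). [folklore]
-/

noncomputable section

open Real Set
open scoped ArithmeticFunction.vonMangoldt

namespace Summit.Ventures.WeilGRH

open Literature.NumberTheory.LFunctions

namespace UniformFloor

variable {q : ℕ}

/-! ## The transcendental inputs -/

/-- `Λ(9)/√9 = log 3/3 ≤ 383993/2^20` (`log 3 ≤ 1.0986122887`). [folklore] -/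
theorem vonMangoldt_nine_div_sqrt_le : (Λ 9 : ℝ) / Real.sqrt ((9 : ℕ) : ℝ) ≤ ((383993 : ℕ) : ℝ) / ((1048576 : ℕ) : ℝ) := by
  have h9 : (Λ 9 : ℝ) = Real.log 3 := by
    rw [show (9 : ℕ) = 3 ^ 2 by norm_num, ArithmeticFunction.vonMangoldt_apply_pow two_ne_zero,
      ArithmeticFunction.vonMangoldt_apply_prime Nat.prime_three]
    norm_num
  have hs : Real.sqrt ((9 : ℕ) : ℝ) = 3 := by
    rw [show ((9 : ℕ) : ℝ) = 3 ^ 2 by norm_num, Real.sqrt_sq (by norm_num)]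
  have h3 := Real.log_three_lt_d9
  rw [h9, hs]
  push_cast
  linarith

/-- The weights of a `JointCert` with the standard `N = 9` table dominate `Λ(n)/√n`. [folklore] -/
theorem hw_of_weights9 (c : JointCert) (hN : c.N = 9) (hD : c.D = 1048576)
    (hW : c.weights = [0, 0, 513950, 665112, 363409, 754726, 0, 771213, 256975, 383993]) :
    ∀ n ∈ Finset.range (c.N + 1), (Λ n : ℝ) / Real.sqrt n ≤ c.wbar n := by
  intro n hn
  rw [hN] at hn
  have hn10 : n < 10 := by simpa using Finset.mem_range.1 hn
  unfold JointCert.wbar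
  rw [hD, hW]
  have h7 : ∀ m < 8, (Λ m : ℝ) / Real.sqrt m ≤ wbar7 m := fun m hm ↦
    wbar7_ge 7 le_rfl m (Finset.mem_range.2 (by omega))
  interval_cases n
  · exact (h7 0 (by norm_num)).trans (by norm_num [wbar7])
  · exact (h7 1 (by norm_num)).trans (by norm_num [wbar7])
  · exact (h7 2 (by norm_num)).trans (by norm_num [wbar7])
  · exact (h7 3 (by norm_num)).trans (by norm_num [wbar7])
  · exact (h7 4 (by norm_num)).trans (by norm_num [wbar7])
  · exact (h7 5 (by norm_num)).trans (by norm_num [wbar7])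
  · exact (h7 6 (by norm_num)).trans (by norm_num [wbar7])
  · exact (h7 7 (by norm_num)).trans (by norm_num [wbar7])
  · simpa using vonMangoldt_eight_div_sqrt_le
  · simpa using vonMangoldt_nine_div_sqrt_le

/-- `log 133 ≥ 7 log 2 + 5/133` (`133 = 128·(133/128)`, `log x ≥ 1 − 1/x`). [folklore] -/
theorem log_133_ge : 7 * Real.log 2 + 5 / 133 ≤ Real.log 133 := by
  have hl : 1 - ((133 : ℝ) / 128)⁻¹ ≤ Real.log ((133 : ℝ) / 128) := Real.one_sub_inv_le_log_of_pos (by norm_num)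
  rw [Real.log_div (by norm_num) (by norm_num), show (128 : ℝ) = 2 ^ 7 by norm_num, Real.log_pow] at hl
  push_cast at hl
  norm_num at hl
  linarith

/-- `log 49 ≥ 4 log 2 + log 3 + 1/49` (`49 = 48·(49/48)`). [folklore] -/
theorem log_49_ge : 4 * Real.log 2 + Real.log 3 + 1 / 49 ≤ Real.log 49 := by
  have hl : 1 - ((49 : ℝ) / 48)⁻¹ ≤ Real.log ((49 : ℝ) / 48) := Real.one_sub_inv_le_log_of_pos (by norm_num)
  rw [Real.log_div (by norm_num) (by norm_num), show (48 : ℝ) = 2 ^ 4 * 3 by norm_num,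
    Real.log_mul (by norm_num) (by norm_num), Real.log_pow] at hl
  push_cast at hl
  norm_num at hl
  linarith

/-- The budget of `certEvenLog9`: `log π + 4.22745354 − Clow/D + RHO/D ≤ log 133`. [folklore] -/
theorem certEvenLog9_budget :
    Real.log Real.pi - (-4.22745354) - (certEvenLog9.Clow : ℝ) / certEvenLog9.D + (certEvenLog9.RHO : ℝ) / certEvenLog9.D ≤
      Real.log (133 : ℕ) := by
  have hπ := Literature.Analysis.SpecialFunctions.Real.log_pi_le
  have h2 := Real.log_two_gt_d9
  have h3 := Real.log_three_gt_d9
  have h133 := log_133_ge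
  rw [show certEvenLog9.Clow = 7676641 from rfl, show certEvenLog9.D = 1048576 from rfl,
    show certEvenLog9.RHO = 7166781 from rfl]
  push_cast
  linarith

/-- The budget of `certOddLog9`: `log π + 1.08586154 − Clow/D + RHO/D ≤ log 49`. [folklore] -/
theorem certOddLog9_budget :
    Real.log Real.pi - (-1.08586154) - (certOddLog9.Clow : ℝ) / certOddLog9.D + (certOddLog9.RHO : ℝ) / certOddLog9.D ≤
      Real.log (49 : ℕ) := by
  have hπ := Literature.Analysis.SpecialFunctions.Real.log_pi_le
  have h2 := Real.log_two_gt_d9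
  have h3 := Real.log_three_gt_d9
  have h49 := log_49_ge
  rw [show certOddLog9.Clow = 4399981 from rfl, show certOddLog9.D = 1048576 from rfl,
    show certOddLog9.RHO = 6132108 from rfl]
  push_cast
  linarith

/-! ## The window contains `[-log 3, log 3]` -/

/-- `log 3 ≤ 352 log(320/319)` (`3·319^352 ≤ 320^352`). [folklore] -/
theorem log_three_le_t (c : JointCert) (hR : c.R = 320) (hJ : c.J = 352) : Real.log 3 ≤ c.t := by
  rw [JointCert.t_eq_log, hR, hJ]
  refine Real.log_le_log (by norm_num) ?_
  rw [div_pow, le_div_iff₀ (by norm_num)]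
  have h0 : (3 : ℝ) * 319 ^ 352 ≤ 320 ^ 352 := by exact_mod_cast (by decide +kernel : 3 * 319 ^ 352 ≤ 320 ^ 352)
  norm_num
  exact h0

/-! ## The cells, reassembled from the two kernel ranges -/

/-- All `352` cells of `certEvenLog9` (`cellsRange 0 176` and `cellsRange 176 176`). [folklore] -/
theorem certEvenLog9_cells : ∀ j < certEvenLog9.J, certEvenLog9.cellOKB j = true := by
  intro j hj
  have hJ : certEvenLog9.J = 352 := rfl
  by_cases h : j < 176
  · exact certEvenLog9.cellsLoop_spec 176 0 (by omega) certEvenLog9_cellsA j (Nat.zero_le _) (by omega)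
  · exact certEvenLog9.cellsLoop_spec 176 176 (by omega) certEvenLog9_cellsB j (by omega) (by omega)

/-- All `352` cells of `certOddLog9`. [folklore] -/
theorem certOddLog9_cells : ∀ j < certOddLog9.J, certOddLog9.cellOKB j = true := by
  intro j hj
  have hJ : certOddLog9.J = 352 := rfl
  by_cases h : j < 176
  · exact certOddLog9.cellsLoop_spec 176 0 (by omega) certOddLog9_cellsA j (Nat.zero_le _) (by omega)
  · exact certOddLog9.cellsLoop_spec 176 176 (by omega) certOddLog9_cellsB j (by omega) (by omega)

/-! ## The floors -/

/-- ★ Every EVEN character of every modulus `q ≥ 133` at the rung `log 3`. [folklore] -/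
theorem weilPositivityOnChar_log_three_of_even_ge_133 (hq : 133 ≤ q) (χ : DirichletCharacter ℂ q) (hpar : charParity χ = 0) :
    WeilPositivityOnChar χ (Real.log 3) := by
  have h := certEvenLog9.weilPositivityOnChar_of_parts certEvenLog9_checkFrame
    certEvenLog9_cells
    (hw_of_weights9 certEvenLog9 rfl rfl rfl) psi_even_ge (Q₀ := 133) (by norm_num) certEvenLog9_budget (by omega) hq χ hpar
  have ht := log_three_le_t certEvenLog9 rfl rfl
  exact fun g hg hsupp ↦ h g hg (hsupp.trans (Icc_subset_Icc (by linarith) ht))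

/-- ★ **Every ODD character of every modulus `q ≥ 49` satisfies Weil positivity on `[-log 3, log 3]`.**
[cite: Weil1952FormulesExplicites, (11) and the «lemme» p. 262] -/
theorem weilPositivityOnChar_log_three_of_odd_ge_49 (hq : 49 ≤ q) (χ : DirichletCharacter ℂ q) (hpar : charParity χ = 1) :
    WeilPositivityOnChar χ (Real.log 3) := by
  have h := certOddLog9.weilPositivityOnChar_of_parts certOddLog9_checkFrame
    certOddLog9_cells
    (hw_of_weights9 certOddLog9 rfl rfl rfl) psi_odd_ge (Q₀ := 49) (by norm_num) certOddLog9_budget (by omega) hq χ hpar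
  have ht := log_three_le_t certOddLog9 rfl rfl
  exact fun g hg hsupp ↦ h g hg (hsupp.trans (Icc_subset_Icc (by linarith) ht))

/-- ★★ **EVERY Dirichlet character (any parity, any values, imprimitive included) of EVERY modulus `q ≥ 133` satisfies Weil
positivity on `[-log 3, log 3]`: `WeilPositivityOnChar χ (log 3)`.** [cite: Weil1952FormulesExplicites, (11) and the «lemme» p. 262] -/
theorem weilPositivityOnChar_log_three_of_ge_133 (hq : 133 ≤ q) (χ : DirichletCharacter ℂ q) :
    WeilPositivityOnChar χ (Real.log 3) := by
  rcases Nat.le_one_iff_eq_zero_or_eq_one.1 (charParity_le_one χ) with h | h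
  · exact weilPositivityOnChar_log_three_of_even_ge_133 hq χ h
  · exact weilPositivityOnChar_log_three_of_odd_ge_49 (by omega) χ h

/-- The same on every window `t ≤ log 3`. [folklore] -/
theorem weilPositivityOnChar_of_le_log_three_of_ge_133 (hq : 133 ≤ q) (χ : DirichletCharacter ℂ q) {t : ℝ}
    (ht : t ≤ Real.log 3) : WeilPositivityOnChar χ t := fun g hg hsupp ↦
  weilPositivityOnChar_log_three_of_ge_133 hq χ g hg (hsupp.trans (Icc_subset_Icc (by linarith) ht))

/-- Odd characters on every window `t ≤ log 3` from `q ≥ 49`. [folklore] -/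
theorem weilPositivityOnChar_of_le_log_three_of_odd_ge_49 (hq : 49 ≤ q) (χ : DirichletCharacter ℂ q)
    (hpar : charParity χ = 1) {t : ℝ} (ht : t ≤ Real.log 3) : WeilPositivityOnChar χ t := fun g hg hsupp ↦
  weilPositivityOnChar_log_three_of_odd_ge_49 hq χ hpar g hg (hsupp.trans (Icc_subset_Icc (by linarith) ht))

end UniformFloor

end Summit.Ventures.WeilGRH

end
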